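import Summits.BirchSwinnertonDyer.BirchSwinnertonDyer.Theorems.PrintCf2SplitBadTwoRestrictedSelmerNoFiniteSubmoduleOfLift
import HarnessLib

/-!
# Crux `PrintCf2.SplitBadTwoRankOneOfFacts` (stmt-BirchSwinnertonDyer-20368), road α v9.1 — brick B17, file 3:
# THE `Σ`-AMBIENT `H_Σ = {c ∈ H¹(K_∞, M) : c locally trivial off Σ and at ∞}` (Greenberg's `H¹(K_Σ/K_∞, M)`): it exists as a
# subgroup, contains `𝔖_𝔮(K_∞, M)`, is `Γ`-stable, and carries the off-`Σ` conditions — so B17 reads VERBATIM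
# «(ii)_Σ ∧ (i)_𝔮 ∧ (hvan)_T ⟹ no nonzero finite `Λ`-submodule», on every S3c₂ frame

Cell `bsd-print-cf2`, EXTRA WIDTH seat `bsd-line-cf2-p1-w4` g8 (prover-bsd-line-cf2-p1-w4-g8-0); `--supports
stmt-BirchSwinnertonDyer-20368` (helper, Theses-free). HONEST FRAMING: nothing here closes the crux or a registered stub; BSD is
not proved by any of this; no summit statement is proved by this seat. No definition, no named fact, no `sorry`. CONDITIONAL on
the three displayed inputs (ii)_Σ, (i)_𝔮, (hvan)_T (TURNKEY-20368-B17-w4g8.md §2: Greenberg 2006 Thm. 1 / LNM 1716 Prop. 4.9-shape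
for the ambient; Prop. 4.13's Remark + `cd_p Γ = 1` at the strict place; local vanishing at the additive places).

Files 1–2 (p660647, p660904) reduced B17 — the hypothesis `hY` of LEAD g11's `control_identity_of_frame_of_noFiniteSubmodule`
(p657357) — to the existence of an ambient `H ⊇ 𝔖_𝔮(K_∞, M)` in `H¹(K_∞, M)` with Greenberg's two inputs. Greenberg's ambient is
`H¹(K_Σ/K_∞, M)`; in the tree's vocabulary (no `K_Σ`) it is the subgroup of classes of `H¹(Gal(K̄/K_∞), M)` all of whose conjugates
are LOCALLY TRIVIAL at every finite place `w ∤ p` outside a set `T` and at every infinite place (for `w ∤ p` over a `ℤ_p`-tower in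
which no place splits completely, "unramified" = "locally trivial"). This file:
* §1 `exists_addSubgroup_mem_iff_sigma` — that ambient EXISTS as an `AddSubgroup` (the conditions are kernels of homomorphisms),
  for any `K`, `p`, `κ`, `M`, `T`;
* §2 for ANY subgroup `H` with that membership (`hmem`): `restrictedSelmerZp_le_of_mem_iff` (`𝔖_𝔮(K_∞, M) ≤ H`),
  `conjH1_mem_of_mem_iff` (`H` is stable under every `conj_σ`, in particular `Γ`-stable — it HAS a `Λ`-module dual),
  `sigmaConditions_of_mem_iff` (the hypothesis `hamb` of file 2's `lift_of_liftAt`);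
* §3 GENERIC ASSEMBLY `forall_finite_eq_bot_of_sigma`: for a `p`-primary `M`, a dual datum `D` of `𝔖_𝔮(K_∞, M)`, such an `H`, and
  ONE `u ≡ 1 (mod p)`: (ii)_Σ `ψ_u(H) = H` ∧ (i)_𝔮 «lift at `𝔮`» ∧ (hvan)_T «`H¹(Gal(K̄/K_∞) ∩ D_w, M) ∋ res c = 0`, `w ∈ T`» ⟹ `D.X` has
  no nonzero finite `Λ`-submodule; `forall_finite_eq_bot_of_sigma_ambientDual` — the generic-`u` form with a Prop. 4.9-shaped
  Pontryagin-dual datum of `H` (finitely generated, no finite submodule) and (i)_𝔮 off finitely many `u`;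
* §4 ROAD α `noFiniteSubmodule_of_frame_of_sigma` — `hY` of p657357 on every S3c₂ frame from (ii)_Σ ∧ (i)_{v̄} ∧ (hvan)_T with
  `T` := the additive places (those above `7d`), i.e. EXACTLY the residue listed in the TURNKEY, nothing else.
presearch: Greenberg LNM 1716 §4 pp. 113, 122–125; Greenberg 2006 Thm. 1; TURNKEY-20368-B17-w4g8.md (crux commit 3871a727aea7) —
no new fact filed.

References: [GreenbergLNM1716] §3 p. 86 (`𝒫`, `𝒢`), §4 Prop. 4.9 (p. 113), pp. 122–125; [Greenberg2006] Thm. 1; [Agboola2007]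
§3 (the conditions of `𝔖_𝔮`), §5 Prop. 5.1.
-/

noncomputable section

open scoped Classical

set_option linter.dupNamespace false
set_option autoImplicit false

open NumberField IsDedekindDomain Field WeierstrassCurve
open Literature.NumberTheory.EllipticCurves Literature.NumberTheory.EllipticCurves.GreenbergSelmer
open Literature.NumberTheory.EllipticCurves.Agboola2007
open Literature.NumberTheory.EllipticCurves.IwasawaAlgebra
open Literature.NumberTheory.EllipticCurves.IwasawaDual
open Literature.NumberTheory.GaloisRepresentations

universe u

namespace Summit.BirchSwinnertonDyer.BirchSwinnertonDyer.Theorems.PrintCf2.RestrictedSelmerPair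

/-! ## §1. The `Σ`-ambient exists as a subgroup -/

section Exists

variable {K : Type u} [Field K] [NumberField K] {p : ℕ} [Fact p.Prime] (κ : ZpExtension K p)
  (M : Type u) [AddCommGroup M] [DistribMulAction (absoluteGaloisGroup K) M] [TopologicalSpace M]
  [DiscreteTopology M]

/-- **The `Σ`-ambient `H_Σ ≤ H¹(K_∞, M)` exists**: the classes `c` such that every conjugate `conj_σ c` restricts to zero on
`Gal(K̄/K_∞) ∩ D_w` for every finite `w ∤ p` OUTSIDE `T` and on `Gal(K̄/K_∞) ∩ D_w` for every infinite `w` form a subgroup (an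
intersection of kernels). With `Σ := T ∪ {w ∣ p} ∪ ∞` this is the tree's stand-in for Greenberg's `H¹(K_Σ/K_∞, M)`.
[cite: GreenbergLNM1716, §3 p. 86 and §4 p. 113] -/
theorem exists_addSubgroup_mem_iff_sigma (T : Set (HeightOneSpectrum (𝓞 K))) :
    ∃ Hamb : AddSubgroup (subgroupH1 κ.kerSubgroup M), ∀ c : subgroupH1 κ.kerSubgroup M, c ∈ Hamb ↔
      (∀ w : HeightOneSpectrum (𝓞 K), ((p : ℕ) : 𝓞 K) ∉ w.asIdeal → w ∉ T → ∀ σ : absoluteGaloisGroup K,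
          resOfLe M (inf_le_left : κ.kerSubgroup ⊓ decomp w ≤ κ.kerSubgroup) (conjH1 κ.kerSubgroup M σ c) = 0) ∧
      (∀ (w : InfinitePlace K) (σ : absoluteGaloisGroup K),
          resOfLe M (inf_le_left : κ.kerSubgroup ⊓ decompInf w ≤ κ.kerSubgroup) (conjH1 κ.kerSubgroup M σ c) = 0) := by
  let P : subgroupH1 κ.kerSubgroup M → Prop := fun c ↦
    (∀ w : HeightOneSpectrum (𝓞 K), ((p : ℕ) : 𝓞 K) ∉ w.asIdeal → w ∉ T → ∀ σ : absoluteGaloisGroup K,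
        resOfLe M (inf_le_left : κ.kerSubgroup ⊓ decomp w ≤ κ.kerSubgroup) (conjH1 κ.kerSubgroup M σ c) = 0) ∧
      (∀ (w : InfinitePlace K) (σ : absoluteGaloisGroup K),
        resOfLe M (inf_le_left : κ.kerSubgroup ⊓ decompInf w ≤ κ.kerSubgroup) (conjH1 κ.kerSubgroup M σ c) = 0)
  have h0 : P 0 := ⟨fun w _ _ σ ↦ by rw [map_zero, map_zero], fun w σ ↦ by rw [map_zero, map_zero]⟩
  have hadd : ∀ {a b}, P a → P b → P (a + b) := fun ⟨ha1, ha2⟩ ⟨hb1, hb2⟩ ↦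
    ⟨fun w hw hwT σ ↦ by rw [map_add, map_add, ha1 w hw hwT σ, hb1 w hw hwT σ, add_zero],
      fun w σ ↦ by rw [map_add, map_add, ha2 w σ, hb2 w σ, add_zero]⟩
  have hneg : ∀ {a}, P a → P (-a) := fun ⟨ha1, ha2⟩ ↦
    ⟨fun w hw hwT σ ↦ by rw [map_neg, map_neg, ha1 w hw hwT σ, neg_zero],
      fun w σ ↦ by rw [map_neg, map_neg, ha2 w σ, neg_zero]⟩
  let S : AddSubgroup (subgroupH1 κ.kerSubgroup M) :=
    { carrier := {c | P c}
      zero_mem' := h0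
      add_mem' := fun ha hb ↦ hadd ha hb
      neg_mem' := fun ha ↦ hneg ha }
  exact ⟨S, fun c ↦ Iff.rfl⟩

end Exists

/-! ## §2. Properties of any subgroup with the `Σ`-membership -/

section Props

variable {K : Type u} [Field K] [NumberField K] {p : ℕ} [Fact p.Prime] {κ : ZpExtension K p}
  {M : Type u} [AddCommGroup M] [DistribMulAction (absoluteGaloisGroup K) M] [TopologicalSpace M]
  [DiscreteTopology M] {𝔮 : HeightOneSpectrum (𝓞 K)} {T : Set (HeightOneSpectrum (𝓞 K))}
  {Hamb : AddSubgroup (subgroupH1 κ.kerSubgroup M)}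
  (hmem : ∀ c : subgroupH1 κ.kerSubgroup M, c ∈ Hamb ↔
      (∀ w : HeightOneSpectrum (𝓞 K), ((p : ℕ) : 𝓞 K) ∉ w.asIdeal → w ∉ T → ∀ σ : absoluteGaloisGroup K,
          resOfLe M (inf_le_left : κ.kerSubgroup ⊓ decomp w ≤ κ.kerSubgroup) (conjH1 κ.kerSubgroup M σ c) = 0) ∧
      (∀ (w : InfinitePlace K) (σ : absoluteGaloisGroup K),
          resOfLe M (inf_le_left : κ.kerSubgroup ⊓ decompInf w ≤ κ.kerSubgroup) (conjH1 κ.kerSubgroup M σ c) = 0))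

include hmem

/-- **`𝔖_𝔮(K_∞, M) ≤ H_Σ`**: the restricted Selmer conditions (locally trivial at EVERY finite `w ∤ p` and at ∞, strict at
`𝔮`) imply the `Σ`-conditions. [cite: Agboola2007, §3 (arXiv p0008:L28–68)] [cite: GreenbergLNM1716, §3 p. 86] -/
theorem restrictedSelmerZp_le_of_mem_iff : restrictedSelmerZp κ M 𝔮 ≤ Hamb := by
  intro c hc
  obtain ⟨h1, h2, -⟩ := (mem_restrictedSelmer_iff_resOfLe κ.kerSubgroup M p 𝔮 c).1 hc
  exact (hmem c).2 ⟨fun w hw _ σ ↦ h1 w hw σ, h2⟩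

/-- **`H_Σ` is stable under every `conj_σ`** (`conj_τ ∘ conj_σ = conj_{τσ}`), in particular under `Γ = ⟨γ⟩`: its Pontryagin dual
is a `Λ`-module, the object of hypothesis (ii)_Σ. [cite: GreenbergLNM1716, §4 p. 113 (the Λ-module H¹(F_Σ/F_∞, E[p^∞]))] -/
theorem conjH1_mem_of_mem_iff (σ : absoluteGaloisGroup K) {c : subgroupH1 κ.kerSubgroup M} (hc : c ∈ Hamb) :
    conjH1 κ.kerSubgroup M σ c ∈ Hamb := by
  obtain ⟨h1, h2⟩ := (hmem c).1 hc
  refine (hmem _).2 ⟨fun w hw hwT τ ↦ ?_, fun w τ ↦ ?_⟩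
  · have e : conjH1 κ.kerSubgroup M τ (conjH1 κ.kerSubgroup M σ c) = conjH1 κ.kerSubgroup M (τ * σ) c := by
      rw [conjH1_mul_holds κ.kerSubgroup M τ σ, AddMonoidHom.comp_apply]
    rw [e]
    exact h1 w hw hwT (τ * σ)
  · have e : conjH1 κ.kerSubgroup M τ (conjH1 κ.kerSubgroup M σ c) = conjH1 κ.kerSubgroup M (τ * σ) c := by
      rw [conjH1_mul_holds κ.kerSubgroup M τ σ, AddMonoidHom.comp_apply]
    rw [e]
    exact h2 w (τ * σ)

/-- `H_Σ` carries the off-`Σ` conditions — the hypothesis `hamb` of file 2's `lift_of_liftAt`, verbatim.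
[cite: GreenbergLNM1716, §4 pp. 122–125] -/
theorem sigmaConditions_of_mem_iff : ∀ c ∈ Hamb,
    (∀ w : HeightOneSpectrum (𝓞 K), ((p : ℕ) : 𝓞 K) ∉ w.asIdeal → w ∉ T → ∀ σ : absoluteGaloisGroup K,
        resOfLe M (inf_le_left : κ.kerSubgroup ⊓ decomp w ≤ κ.kerSubgroup) (conjH1 κ.kerSubgroup M σ c) = 0) ∧
    (∀ (w : InfinitePlace K) (σ : absoluteGaloisGroup K),
        resOfLe M (inf_le_left : κ.kerSubgroup ⊓ decompInf w ≤ κ.kerSubgroup) (conjH1 κ.kerSubgroup M σ c) = 0) :=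
  fun c hc ↦ (hmem c).1 hc

end Props

/-! ## §3. Generic assembly: (ii)_Σ ∧ (i)_𝔮 ∧ (hvan)_T ⟹ no nonzero finite `Λ`-submodule -/

section Assembly

variable {K : Type u} [Field K] [NumberField K] {p : ℕ} [Fact p.Prime] {κ : ZpExtension K p}
  {M : Type u} [AddCommGroup M] [DistribMulAction (absoluteGaloisGroup K) M] [TopologicalSpace M]
  [DiscreteTopology M] {𝔮 : HeightOneSpectrum (𝓞 K)} {γ : absoluteGaloisGroup K}

/-- **B17 from Greenberg's inputs at the `Σ`-ambient, generic.** `M` `p`-primary, `D` a dual datum of `𝔖_𝔮(K_∞, M)`, `T` a set of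
finite places, `H` a subgroup of `H¹(K_∞, M)` with the `Σ`-membership (§1–§2), `u ≡ 1 (mod p)`. If
(ii)_Σ `ψ_u = u·conj_γ − 1` maps `H` onto `H`; (hvan)_T every class of `H¹(K_∞, M)` restricts to zero on `Gal(K̄/K_∞) ∩ D_w`
for `w ∈ T`, `w ∤ p`; (i)_𝔮 every `c ∈ H` all of whose conjugates of `ψ_u c` die on `Gal(K̄/K_∞) ∩ D_𝔮` is congruent there (all
conjugates) to a `ψ_u`-invariant `c' ∈ H` — then `D.X` has no nonzero finite `Λ`-submodule (files 1–2: `lift_of_liftAt`,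
`forall_finite_eq_bot_of_lift`). [cite: GreenbergLNM1716, §4 Prop. 4.9 (p. 113), pp. 122–125] [cite: Agboola2007, §5 Prop. 5.1] -/
theorem forall_finite_eq_bot_of_sigma (D : RestrictedDualData κ M 𝔮 γ) (htor : ∀ m : M, ∃ k : ℕ, p ^ k • m = 0)
    (T : Set (HeightOneSpectrum (𝓞 K))) (Hamb : AddSubgroup (subgroupH1 κ.kerSubgroup M))
    (hmem : ∀ c : subgroupH1 κ.kerSubgroup M, c ∈ Hamb ↔
      (∀ w : HeightOneSpectrum (𝓞 K), ((p : ℕ) : 𝓞 K) ∉ w.asIdeal → w ∉ T → ∀ σ : absoluteGaloisGroup K,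
          resOfLe M (inf_le_left : κ.kerSubgroup ⊓ decomp w ≤ κ.kerSubgroup) (conjH1 κ.kerSubgroup M σ c) = 0) ∧
      (∀ (w : InfinitePlace K) (σ : absoluteGaloisGroup K),
          resOfLe M (inf_le_left : κ.kerSubgroup ⊓ decompInf w ≤ κ.kerSubgroup) (conjH1 κ.kerSubgroup M σ c) = 0))
    {u : ℤ} (hu : (p : ℤ) ∣ u - 1)
    (hsurj : ∀ s ∈ Hamb, ∃ c ∈ Hamb, u • conjH1 κ.kerSubgroup M γ c - c = s)
    (hvan : ∀ w ∈ T, ((p : ℕ) : 𝓞 K) ∉ w.asIdeal → ∀ c : subgroupH1 κ.kerSubgroup M,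
      resOfLe M (inf_le_left : κ.kerSubgroup ⊓ decomp w ≤ κ.kerSubgroup) c = 0)
    (hliftAt : ∀ c ∈ Hamb,
      (∀ σ : absoluteGaloisGroup K, resOfLe M (inf_le_left : κ.kerSubgroup ⊓ decomp 𝔮 ≤ κ.kerSubgroup)
          (conjH1 κ.kerSubgroup M σ (u • conjH1 κ.kerSubgroup M γ c - c)) = 0) →
      ∃ c' ∈ Hamb, u • conjH1 κ.kerSubgroup M γ c' - c' = 0 ∧
        ∀ σ : absoluteGaloisGroup K, resOfLe M (inf_le_left : κ.kerSubgroup ⊓ decomp 𝔮 ≤ κ.kerSubgroup)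
          (conjH1 κ.kerSubgroup M σ (c - c')) = 0) :
    ∀ N : Submodule (IwasawaAlgebra p) D.X, Finite N → N = ⊥ :=
  forall_finite_eq_bot_of_lift D htor Hamb (restrictedSelmerZp_le_of_mem_iff hmem) hu hsurj
    (lift_of_liftAt κ M 𝔮 γ Hamb T (sigmaConditions_of_mem_iff hmem) hvan u hliftAt)

/-- **The generic-`u` form at the `Σ`-ambient.** As above, but with (ii)_Σ supplied à la Prop. 4.9: `H` admits a FINITELY GENERATED
Pontryagin-dual datum `(Y, toDual_Y)` (`T ↦ conj_γ − 1`, constants through `ℤ_p → ℤ/p^k`) WITHOUT nonzero finite `Λ`-submodules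
(for our `H`: Greenberg 2006 Thm. 1 applied to `Ind(M)`), and (i)_𝔮 failing for finitely many `u ≡ 1 (mod p)` only; (hvan)_T as
above. Then every dual datum of `𝔖_𝔮(K_∞, M)` has no nonzero finite `Λ`-submodule.
[cite: GreenbergLNM1716, §4 Prop. 4.9 (p. 113), pp. 117, 122–125] [cite: Greenberg2016Selmer, Prop. 2.6.1] -/
theorem forall_finite_eq_bot_of_sigma_ambientDual (D : RestrictedDualData κ M 𝔮 γ)
    (htor : ∀ m : M, ∃ k : ℕ, p ^ k • m = 0)
    (T : Set (HeightOneSpectrum (𝓞 K))) (Hamb : AddSubgroup (subgroupH1 κ.kerSubgroup M))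
    (hmem : ∀ c : subgroupH1 κ.kerSubgroup M, c ∈ Hamb ↔
      (∀ w : HeightOneSpectrum (𝓞 K), ((p : ℕ) : 𝓞 K) ∉ w.asIdeal → w ∉ T → ∀ σ : absoluteGaloisGroup K,
          resOfLe M (inf_le_left : κ.kerSubgroup ⊓ decomp w ≤ κ.kerSubgroup) (conjH1 κ.kerSubgroup M σ c) = 0) ∧
      (∀ (w : InfinitePlace K) (σ : absoluteGaloisGroup K),
          resOfLe M (inf_le_left : κ.kerSubgroup ⊓ decompInf w ≤ κ.kerSubgroup) (conjH1 κ.kerSubgroup M σ c) = 0))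
    {Y : Type*} [AddCommGroup Y] [Module (IwasawaAlgebra p) Y] [Module.Finite (IwasawaAlgebra p) Y]
    (dY : Y →+ (Hamb →+ AddCircle (1 : ℚ))) (hbijY : Function.Bijective dY)
    (hTY : ∀ (y : Y) (c : Hamb), dY ((PowerSeries.X : IwasawaAlgebra p) • y) c =
      dY y ⟨conjH1 κ.kerSubgroup M γ c, conjH1_mem_of_mem_iff hmem γ c.2⟩ - dY y c)
    (hCY : ∀ (a : ℤ_[p]) (y : Y) (c : Hamb) (k : ℕ), (p ^ k) • c = 0 →
      dY (PowerSeries.C a • y) c = (PadicInt.toZModPow k a).val • dY y c)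
    (hY : ∀ N : Submodule (IwasawaAlgebra p) Y, Finite N → N = ⊥)
    (hvan : ∀ w ∈ T, ((p : ℕ) : 𝓞 K) ∉ w.asIdeal → ∀ c : subgroupH1 κ.kerSubgroup M,
      resOfLe M (inf_le_left : κ.kerSubgroup ⊓ decomp w ≤ κ.kerSubgroup) c = 0)
    (hliftAt : {u : ℤ | (p : ℤ) ∣ u - 1 ∧ ¬ ∀ c ∈ Hamb,
      (∀ σ : absoluteGaloisGroup K, resOfLe M (inf_le_left : κ.kerSubgroup ⊓ decomp 𝔮 ≤ κ.kerSubgroup)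
          (conjH1 κ.kerSubgroup M σ (u • conjH1 κ.kerSubgroup M γ c - c)) = 0) →
      ∃ c' ∈ Hamb, u • conjH1 κ.kerSubgroup M γ c' - c' = 0 ∧
        ∀ σ : absoluteGaloisGroup K, resOfLe M (inf_le_left : κ.kerSubgroup ⊓ decomp 𝔮 ≤ κ.kerSubgroup)
          (conjH1 κ.kerSubgroup M σ (c - c')) = 0}.Finite) :
    ∀ N : Submodule (IwasawaAlgebra p) D.X, Finite N → N = ⊥ := by
  refine forall_finite_eq_bot_of_ambientDual_of_lift D htor Hamb (restrictedSelmerZp_le_of_mem_iff hmem)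
    (fun c hc ↦ conjH1_mem_of_mem_iff hmem γ hc) dY hbijY hTY hCY hY (hliftAt.subset ?_)
  rintro u ⟨hu, hnot⟩
  refine ⟨hu, fun h ↦ hnot ?_⟩
  exact lift_of_liftAt κ M 𝔮 γ Hamb T (sigmaConditions_of_mem_iff hmem) hvan u h

end Assembly

/-! ## §4. Road α: `hY` of p657357 on every S3c₂ frame = (ii)_Σ ∧ (i)_{v̄} ∧ (hvan)_T -/

section Frame

variable {K : Type} [Field K] [NumberField K]

/-- **B17 on an S3c₂ frame is EXACTLY (ii)_Σ ∧ (i)_{v̄} ∧ (hvan)_T.** For a member `C • W = cm7^{(d)}` base-changed to `K`, `π`, `r`,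
a `ℤ₂`-line `κ'` with `γ'`, `W* = E[𝔮_r^∞]`, the strict place `v̄`, a set `T` of finite places (intended: those above `7d`, the
additive places of `W_K` away from `2`), the `Σ`-ambient `H` (membership `hmem`, §1), and one odd `u`: if (ii)_Σ `ψ_u(H) = H`,
(hvan)_T `H¹(Gal(K̄/K*_∞) ∩ D_w, W*) ∋ res c = 0` for `w ∈ T`, and (i)_{v̄} the lift at `v̄`, then EVERY dual datum `D` of
`𝔖_{v̄}(K*_∞, W*)` has no nonzero finite `Λ`-submodule — the hypothesis `hY` of LEAD g11's
`control_identity_of_frame_of_noFiniteSubmodule` (p657357). [cite: GreenbergLNM1716, §4 pp. 113, 122–125] [cite: Agboola2007, §5 Prop. 5.1] -/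
theorem noFiniteSubmodule_of_frame_of_sigma (W : WeierstrassCurve ℚ) [W.IsElliptic]
    (π : (W.baseChange K).endRing) (r : ℤ_[2]) (κ' : ZpExtension K 2) (γ' : absoluteGaloisGroup K)
    (vbar : HeightOneSpectrum (𝓞 K))
    (D : RestrictedDualData κ' ↥((W.baseChange K).endEigenPrimaryTorsion 2 π r) vbar γ')
    (T : Set (HeightOneSpectrum (𝓞 K)))
    (Hamb : AddSubgroup (subgroupH1 κ'.kerSubgroup ↥((W.baseChange K).endEigenPrimaryTorsion 2 π r)))
    (hmem : ∀ c : subgroupH1 κ'.kerSubgroup ↥((W.baseChange K).endEigenPrimaryTorsion 2 π r), c ∈ Hamb ↔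
      (∀ w : HeightOneSpectrum (𝓞 K), ((2 : ℕ) : 𝓞 K) ∉ w.asIdeal → w ∉ T → ∀ σ : absoluteGaloisGroup K,
          resOfLe ↥((W.baseChange K).endEigenPrimaryTorsion 2 π r) (inf_le_left : κ'.kerSubgroup ⊓ decomp w ≤ κ'.kerSubgroup)
            (conjH1 κ'.kerSubgroup ↥((W.baseChange K).endEigenPrimaryTorsion 2 π r) σ c) = 0) ∧
      (∀ (w : InfinitePlace K) (σ : absoluteGaloisGroup K),
          resOfLe ↥((W.baseChange K).endEigenPrimaryTorsion 2 π r) (inf_le_left : κ'.kerSubgroup ⊓ decompInf w ≤ κ'.kerSubgroup)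
            (conjH1 κ'.kerSubgroup ↥((W.baseChange K).endEigenPrimaryTorsion 2 π r) σ c) = 0))
    {u : ℤ} (hu : (2 : ℤ) ∣ u - 1)
    (hsurj : ∀ s ∈ Hamb, ∃ c ∈ Hamb,
      u • conjH1 κ'.kerSubgroup ↥((W.baseChange K).endEigenPrimaryTorsion 2 π r) γ' c - c = s)
    (hvan : ∀ w ∈ T, ((2 : ℕ) : 𝓞 K) ∉ w.asIdeal →
      ∀ c : subgroupH1 κ'.kerSubgroup ↥((W.baseChange K).endEigenPrimaryTorsion 2 π r),
        resOfLe ↥((W.baseChange K).endEigenPrimaryTorsion 2 π r) (inf_le_left : κ'.kerSubgroup ⊓ decomp w ≤ κ'.kerSubgroup) c = 0)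
    (hliftAt : ∀ c ∈ Hamb,
      (∀ σ : absoluteGaloisGroup K,
        resOfLe ↥((W.baseChange K).endEigenPrimaryTorsion 2 π r) (inf_le_left : κ'.kerSubgroup ⊓ decomp vbar ≤ κ'.kerSubgroup)
          (conjH1 κ'.kerSubgroup ↥((W.baseChange K).endEigenPrimaryTorsion 2 π r) σ
            (u • conjH1 κ'.kerSubgroup ↥((W.baseChange K).endEigenPrimaryTorsion 2 π r) γ' c - c)) = 0) →
      ∃ c' ∈ Hamb, u • conjH1 κ'.kerSubgroup ↥((W.baseChange K).endEigenPrimaryTorsion 2 π r) γ' c' - c' = 0 ∧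
        ∀ σ : absoluteGaloisGroup K,
          resOfLe ↥((W.baseChange K).endEigenPrimaryTorsion 2 π r) (inf_le_left : κ'.kerSubgroup ⊓ decomp vbar ≤ κ'.kerSubgroup)
            (conjH1 κ'.kerSubgroup ↥((W.baseChange K).endEigenPrimaryTorsion 2 π r) σ (c - c')) = 0) :
    ∀ N : Submodule (IwasawaAlgebra 2) D.X, Finite N → N = ⊥ := by
  haveI : (W.baseChange K).IsElliptic := by rw [baseChange]; infer_instance
  have htor := exists_pow_smul_endEigenPrimaryTorsion_eq_zero (W.baseChange K) 2 π r
  exact forall_finite_eq_bot_of_sigma D htor T Hamb hmem (by exact_mod_cast hu) hsurj hvan hliftAt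

end Frame

end Summit.BirchSwinnertonDyer.BirchSwinnertonDyer.Theorems.PrintCf2.RestrictedSelmerPair

end
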